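import Summits.Ventures.CertifiedManyBodySolver.Observables.PairLROTowerChargedReadingTwistedFlipAux
import Literature.MathematicalPhysics.QuantumLattice.InfVolFermionStateTwistedFlipAction
import HarnessLib

/-!
# OP1-C, part 17: CLASS TRANSFER of auxiliary `word:X` nodes under the flip-twist (node-file tool, TIGHT form)

HONEST FRAMING: first certified bounds on pairing observables; not a superconductivity verdict; a ceiling route,
never presence; nothing in this file is a number. Crew hubbard-obs (D-0042), seat hubbard-obs-p1
(`prover-hubbard-obs-p1-g10-0`); lead RULING (fr) d210 («(ex2) GO», 2026-08-27). Zero compute; no definition beyond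
the section-local `DecidableEq` shim of the sibling file PairLROTowerChargedTwistFlip; no named fact; no `sorry`.

The producer of the Stage-B certified-B cells (sr-mbsolver-menu-3, kit j261965 / j266080) certifies the auxiliary
two-sided one-point bounds of the NN pair generator on its SPIN-FLIP PARTNER (`C(-1,-1,d)*C(-1,0,u)` for the cell word
`C(-1,-1,u)*C(-1,0,d)`: same identification class). This file makes the transfer a kernel fact:

* **`orbitState_twistedFlipSpaceGroupUnitary_fermionEmbed_spinSwapIter_gaugeConj`** — the flip-twisted orbit state is
  INVARIANT under the flip–gauge image of a window observable: `ω̄^{twf}_ζ(Γ_L(F^{f}(𝒢_k Y 𝒢_kᴴ))) = ω̄^{twf}_ζ(Γ_L Y)`,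
  `k = twistFlipExp 1 f m` (`orbitState_conj_of_closed` + `twistedFlipSpaceGroupUnitary_closed` +
  `fockGauge_conj_fermionEmbed` + `fermionEmbed_toTorusEmb_spinSwapIter`);
* for a ladder word, `ω̄^{twf}_ζ(Γ_L W) = φ_k(W)·ω̄^{twf}_ζ(Γ_L(F^{f} W))`; for charge `±2`, `f = 1`, `m = 0`:
  **`Re ω̄^{twf}_ζ(Γ_L W) = −Re ω̄^{twf}_ζ(Γ_L(F W))`** (`gaugePhase_of_charge_two`) — the producer's
  «a word of net charge q transforms with the extra sign (−1)^{q/2}»;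
* **`twistedFlip_onePoint_node_of_spinSwap_charge_two`** — hence a flip-twisted one-point node certified on `a • F W`
  IS the node on `(−a) • W` (feed it to `twistedFlip_hauxp_of_twoSided` / `_hauxm_of_twoSided`,
  PairLROTowerChargedAuxAssembly); `spinSwapIter_one_ladderWord` identifies `F W` with the letter-flipped word.

References: O. Bratteli, D. W. Robinson, *Operator Algebras and Quantum Statistical Mechanics 2* (1997) §5.2.2,
§6.2.4 [BratteliRobinsonII1997]; X. Han, arXiv:2006.06002 §2–§3 [Han2020Bootstrap]; T. Koma, H. Tasaki,
J. Stat. Phys. 76 (1994) 745, Theorem 5 [KomaTasaki1994].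
-/

noncomputable section

namespace Summit.Ventures.CertifiedManyBodySolver.Observables

open Matrix Complex Finset Literature.MathematicalPhysics.QuantumLattice Literature.Probability.LatticeModels
open Literature.MathematicalPhysics.QuantumLattice.HubbardWave0
open Literature.MathematicalPhysics.QuantumManyBody.StateRelaxation
open scoped ComplexOrder ComplexConjugate BigOperators

/-! ### §1  Class transfer: the flip-twisted orbit state is invariant under the flip–gauge image of a word -/

section Transfer

variable {L : ℕ} [NeZero L]

/-- (Local to this section: the `DecidableEq (FermionTorus 2 L)` shim under which `TwistedFlipSpaceGroupUnitary`
states its matrix powers `F^f`.) [folklore] -/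
local instance (priority := high) instDecidableEqFermionTorusTwFlipAuxTr : DecidableEq (FermionTorus 2 L) :=
  LinearOrder.toDecidableEq

variable {Λ' : Finset (Site 2)}

/-- The member `F^{f} 𝒢_{f+2m}` of the flip-twisted family (translation `0`, lattice element `1`) conjugates the torus
image of a window observable `Y` into the torus image of `F^{f}(𝒢_k Y 𝒢_kᴴ)`, `k = twistFlipExp 1 f m`.
[cite: BratteliRobinsonII1997, §5.2.2] -/
theorem twistedFlipSpaceGroupUnitary_one_conj_fermionEmbed {S : Finset (DihedralGroup 4)}
    (h1 : (1 : DihedralGroup 4) ∈ S) (f₀ m₀ : Fin 2) (h : Set.InjOn (Torus.proj (d := 2) L) ↑Λ') (Y : FermionOp Λ') :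
    twistedFlipSpaceGroupUnitary S ((((0 : TorusSite 2 L), (⟨1, h1⟩ : ↥S)), f₀), m₀) *
        fermionEmbed (PolySite.toTorusEmb L h) Y *
        (twistedFlipSpaceGroupUnitary S ((((0 : TorusSite 2 L), (⟨1, h1⟩ : ↥S)), f₀), m₀))ᴴ =
      fermionEmbed (PolySite.toTorusEmb L h)
        (spinSwapIter (f₀ : ℕ) (fockGauge (twistFlipExp 1 f₀ m₀) * Y * (fockGauge (twistFlipExp 1 f₀ m₀))ᴴ)) := by
  have hsg : spaceGroupUnitary S ((0 : TorusSite 2 L), (⟨1, h1⟩ : ↥S)) = 1 := by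
    show (fockTranslate (0 : TorusSite 2 L)).val * (fockD4 (L := L) (1 : DihedralGroup 4)).val = 1
    rw [fockTranslate_zero, map_one]
    show ((1 : Matrix.unitaryGroup (Finset (Orb (FermionTorus 2 L))) ℂ).val :
        Matrix (Finset (Orb (FermionTorus 2 L))) (Finset (Orb (FermionTorus 2 L))) ℂ) *
      ((1 : Matrix.unitaryGroup (Finset (Orb (FermionTorus 2 L))) ℂ).val :
        Matrix (Finset (Orb (FermionTorus 2 L))) (Finset (Orb (FermionTorus 2 L))) ℂ) = 1
    rw [show ((1 : Matrix.unitaryGroup (Finset (Orb (FermionTorus 2 L))) ℂ).val :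
        Matrix (Finset (Orb (FermionTorus 2 L))) (Finset (Orb (FermionTorus 2 L))) ℂ) = 1 from rfl, Matrix.mul_one]
  rw [twistedFlipSpaceGroupUnitary_apply]
  show spaceGroupUnitary S ((0 : TorusSite 2 L), (⟨1, h1⟩ : ↥S)) * fockSpinFlip ^ (f₀ : ℕ) *
      fockGauge (twistFlipExp 1 f₀ m₀) * fermionEmbed (PolySite.toTorusEmb L h) Y *
      (spaceGroupUnitary S ((0 : TorusSite 2 L), (⟨1, h1⟩ : ↥S)) * fockSpinFlip ^ (f₀ : ℕ) *
        fockGauge (twistFlipExp 1 f₀ m₀))ᴴ = _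
  rw [hsg, Matrix.one_mul, fermionEmbed_toTorusEmb_spinSwapIter, ← fockGauge_conj_fermionEmbed, conjTranspose_mul]
  simp only [Matrix.mul_assoc]

/-- **The flip-twisted orbit state is invariant under the flip–gauge image of a window observable**: for `1 ∈ S`,
`S` closed under multiplication, `ω̄^{twf}_ζ(Γ_L(F^{f}(𝒢_k Y 𝒢_kᴴ))) = ω̄^{twf}_ζ(Γ_L Y)`, `k = twistFlipExp 1 f m`
(reindex the orbit: Han 2020 §2 eq. (2), `F[U⁻¹OU] = F[O]`). [cite: Han2020Bootstrap, §2 eq. (2)]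
[cite: BratteliRobinsonII1997, §6.2.4] -/
theorem orbitState_twistedFlipSpaceGroupUnitary_fermionEmbed_spinSwapIter_gaugeConj {S : Finset (DihedralGroup 4)}
    (h1 : (1 : DihedralGroup 4) ∈ S) (hmul : ∀ a ∈ S, ∀ b ∈ S, a * b ∈ S) (f₀ m₀ : Fin 2)
    (h : Set.InjOn (Torus.proj (d := 2) L) ↑Λ') (Y : FermionOp Λ') (ζ : Fock (Orb (FermionTorus 2 L))) :
    orbitState (twistedFlipSpaceGroupUnitary S) ζ (fermionEmbed (PolySite.toTorusEmb L h)
        (spinSwapIter (f₀ : ℕ) (fockGauge (twistFlipExp 1 f₀ m₀) * Y * (fockGauge (twistFlipExp 1 f₀ m₀))ᴴ))) =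
      orbitState (twistedFlipSpaceGroupUnitary S) ζ (fermionEmbed (PolySite.toTorusEmb L h) Y) := by
  obtain ⟨σ, hσ⟩ := twistedFlipSpaceGroupUnitary_closed (L := L) hmul (0 : TorusSite 2 L) h1 f₀ m₀
  rw [← twistedFlipSpaceGroupUnitary_one_conj_fermionEmbed h1 f₀ m₀ h Y]
  exact orbitState_conj_of_closed (twistedFlipSpaceGroupUnitary S) ζ ⟨σ, hσ⟩ _

/-- **Ladder words: `ω̄^{twf}_ζ(Γ_L W) = φ_k(W) · ω̄^{twf}_ζ(Γ_L(F^{f} W))`**, `φ_k(W) = gaugePhase k W = i^{k q(W)}`,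
`k = twistFlipExp 1 f m`. [cite: Han2020Bootstrap, §2] [cite: BratteliRobinsonII1997, §6.2.4] -/
theorem orbitState_twistedFlip_fermionEmbed_ladderWord_eq_gaugePhase_mul {S : Finset (DihedralGroup 4)}
    (h1 : (1 : DihedralGroup 4) ∈ S) (hmul : ∀ a ∈ S, ∀ b ∈ S, a * b ∈ S) (f₀ m₀ : Fin 2)
    (h : Set.InjOn (Torus.proj (d := 2) L) ↑Λ') (l : List (Orb (PolySite Λ') × Bool))
    (ζ : Fock (Orb (FermionTorus 2 L))) :
    orbitState (twistedFlipSpaceGroupUnitary S) ζ (fermionEmbed (PolySite.toTorusEmb L h) (ladderWord l)) =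
      gaugePhase (twistFlipExp 1 f₀ m₀) l *
        orbitState (twistedFlipSpaceGroupUnitary S) ζ
          (fermionEmbed (PolySite.toTorusEmb L h) (spinSwapIter (f₀ : ℕ) (ladderWord l))) := by
  rw [← orbitState_twistedFlipSpaceGroupUnitary_fermionEmbed_spinSwapIter_gaugeConj h1 hmul f₀ m₀ h (ladderWord l) ζ,
    fockGauge_conj_ladderWord, spinSwapIter_smul, fermionEmbed_smul, map_smul, smul_eq_mul]

/-- `F W` for a ladder word is the ladder word of the spin-exchanged letters. [cite: BratteliRobinsonII1997, §5.2.2] -/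
theorem spinSwapIter_one_ladderWord (l : List (Orb (PolySite Λ') × Bool)) :
    spinSwapIter 1 (ladderWord l : FermionOp Λ') =
      ladderWord (l.map fun p => ((Orb.spinSwap : Orb (PolySite Λ') ≃ Orb (PolySite Λ')) p.1, p.2)) := by
  change spinSwapIter (0 + 1) (ladderWord l : FermionOp Λ') = _
  rw [spinSwapIter_succ, spinSwapIter_zero, relabel_ladderWord]

/-- **Charge `±2` words change sign under the flip-twist**: `Re ω̄^{twf}_ζ(Γ_L W) = −Re ω̄^{twf}_ζ(Γ_L(F W))`
(`f = 1`, `m = 0`, `k = 1`, `φ₁(W) = −1` by `gaugePhase_of_charge_two` / `_neg_two`) — the producer's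
«a word of net charge q transforms with the extra sign (−1)^{q/2}». [cite: Han2020Bootstrap, §2] -/
theorem re_orbitState_twistedFlip_fermionEmbed_ladderWord_of_charge_two {S : Finset (DihedralGroup 4)}
    (h1 : (1 : DihedralGroup 4) ∈ S) (hmul : ∀ a ∈ S, ∀ b ∈ S, a * b ∈ S)
    (h : Set.InjOn (Torus.proj (d := 2) L) ↑Λ') {l : List (Orb (PolySite Λ') × Bool)}
    (hl : ladderCharge l = 2 ∨ ladderCharge l = -2) (ζ : Fock (Orb (FermionTorus 2 L))) :
    (orbitState (twistedFlipSpaceGroupUnitary S) ζ (fermionEmbed (PolySite.toTorusEmb L h) (ladderWord l))).re =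
      -(orbitState (twistedFlipSpaceGroupUnitary S) ζ
          (fermionEmbed (PolySite.toTorusEmb L h) (spinSwapIter 1 (ladderWord l)))).re := by
  have hk : twistFlipExp (1 : DihedralGroup 4) (1 : Fin 2) (0 : Fin 2) = 1 := by
    simp [twistFlipExp, b1gTwist_one]
  have hφ : gaugePhase (twistFlipExp (1 : DihedralGroup 4) (1 : Fin 2) (0 : Fin 2)) l = -1 := by
    rw [hk]
    rcases hl with hl | hl
    · rw [gaugePhase_of_charge_two 1 hl, pow_one]
    · rw [gaugePhase_of_charge_neg_two 1 hl, pow_one]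
  rw [orbitState_twistedFlip_fermionEmbed_ladderWord_eq_gaugePhase_mul h1 hmul 1 0 h l ζ, hφ, neg_one_mul,
    Complex.neg_re]
  rfl

/-- **Node transfer across the flip class (charge `±2`).** A flip-twisted one-point node certified on the word
`a • F W` (any scalar `a`; e.g. the producer's auxiliary `word:X` certificate on the spin-flip partner of the cell's
generator) IS the same node on `(−a) • W`. [cite: KomaTasaki1994, Theorem 5] [cite: Han2020Bootstrap, §2] -/
theorem twistedFlip_onePoint_node_of_spinSwap_charge_two {S : Finset (DihedralGroup 4)}
    (h1 : (1 : DihedralGroup 4) ∈ S) (hmul : ∀ a ∈ S, ∀ b ∈ S, a * b ∈ S) (t t' U u ν₀ : ℝ) {c A m k : ℝ}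
    (a : ℂ) {l : List (Orb (PolySite Λ') × Bool)} (hl : ladderCharge l = 2 ∨ ladderCharge l = -2)
    (h : Set.InjOn (Torus.proj (d := 2) L) ↑Λ') (ζ : Fock (Orb (FermionTorus 2 L)))
    (hnode : c - A + m * ((star ζ ⬝ᵥ ((totalNumber : Matrix (Finset (Orb (FermionTorus 2 L))) _ ℂ) *ᵥ ζ)).re /
          (L : ℝ) ^ 2 - ν₀) +
        k * (u - (star ζ ⬝ᵥ (hubbardTorusTT' L t t' U *ᵥ ζ)).re / (L : ℝ) ^ 2) ≤
        (orbitState (twistedFlipSpaceGroupUnitary S) ζ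
          (fermionEmbed (PolySite.toTorusEmb L h) (a • spinSwapIter 1 (ladderWord l)))).re) :
    c - A + m * ((star ζ ⬝ᵥ ((totalNumber : Matrix (Finset (Orb (FermionTorus 2 L))) _ ℂ) *ᵥ ζ)).re /
          (L : ℝ) ^ 2 - ν₀) +
        k * (u - (star ζ ⬝ᵥ (hubbardTorusTT' L t t' U *ᵥ ζ)).re / (L : ℝ) ^ 2) ≤
      (orbitState (twistedFlipSpaceGroupUnitary S) ζ
        (fermionEmbed (PolySite.toTorusEmb L h) ((-a) • ladderWord l))).re := by
  have key : orbitState (twistedFlipSpaceGroupUnitary S) ζ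
        (fermionEmbed (PolySite.toTorusEmb L h) ((-a) • ladderWord l)) =
      orbitState (twistedFlipSpaceGroupUnitary S) ζ
        (fermionEmbed (PolySite.toTorusEmb L h) (a • spinSwapIter 1 (ladderWord l))) := by
    have hk : twistFlipExp (1 : DihedralGroup 4) (1 : Fin 2) (0 : Fin 2) = 1 := by
      simp [twistFlipExp, b1gTwist_one]
    have hφ : gaugePhase (twistFlipExp (1 : DihedralGroup 4) (1 : Fin 2) (0 : Fin 2)) l = -1 := by
      rw [hk]
      rcases hl with hl | hl
      · rw [gaugePhase_of_charge_two 1 hl, pow_one]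
      · rw [gaugePhase_of_charge_neg_two 1 hl, pow_one]
    rw [fermionEmbed_smul, fermionEmbed_smul, map_smul, map_smul, smul_eq_mul, smul_eq_mul,
      orbitState_twistedFlip_fermionEmbed_ladderWord_eq_gaugePhase_mul h1 hmul 1 0 h l ζ, hφ,
      show ((1 : Fin 2) : ℕ) = 1 from rfl]
    ring
  rw [key]
  exact hnode

end Transfer

end Summit.Ventures.CertifiedManyBodySolver.Observables

end
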